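import Summits.HubbardSuperconductivity.HubbardSuperconductivity.Theorems.AnisotropyChordTransferFibre3RowDCellCheck
import Summits.HubbardSuperconductivity.HubbardSuperconductivity.Theorems.AnisotropyChordTransferFibre3RowDSymm

/-!
# Route `AnisotropyChord` / H0 rotor rung, row D (KT-2a): the ORBIT form of the row-D cell certificate (6 kernel checks per cell)

By `…RowDSymm` the low-shell term `T(k) = |R̂′(k)|²/(V² den(k))` is constant on the orbits of the group generated by
`2 ↔ 3`, `1 ↔ 2` and the `y`-reflection; on the 45 classes of `lowList` there are 6 orbits (sizes 12, 12, 6, 6, 6, 3).  This file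
turns that into a kernel-checkable certificate: integer generator words (★ `genZ`, `wordZ`; ★ `lowTerm_wordZ`: `T(w·k) = T(k)`),
an orbit table `orb = [(k, j, w)]` over `lowList` with `w·k = r_j` checked by `decide` (★ `orbitRowOk`), a representative table
`reps = [(r_j, b_j)]` each certified by ONE kernel class check `RowD.classCheck … r_j b_j` (and `r_j ∈ lowList`), the budget
`Σ_k b_{j(k)} ≤ 3·(98696/10⁴)·a_D·ν₁·τlo`, the `ê₁` and `τ` checks ⟹ ★★★ `lowG_of_orbitChecks`: `lowGForm ≤ a_D·η_eff·U` on the cell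
for every `L ≥ 128` (the `hKT2a` hypothesis of `gm3_of_cell`) — 6 class evaluations instead of 45 (`lowG_of_classChecks`).
Also ★ `lowG_of_rowBounds`: the common tail (table of real row bounds ⟹ the cell bound).
Prover seat `hubbard-h0-rotor-p1` g30 (route lead); helper for piece A = stmt-HubbardSuperconductivity-23918 of rung 19089
(`--supports`, helper class).  Nothing here proves superconductivity in the Hubbard model.  Tree imports only; no sorry.
-/

set_option linter.dupNamespace false
set_option autoImplicit false

open scoped BigOperators
open Literature.Analysis.ValidatedNumerics

namespace Summit.HubbardSuperconductivity.HubbardSuperconductivity.Theorems.AnisotropyChord.Transfer.Fibre3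

namespace RowD

open RowC L2.N1

variable (L : ℕ) [NeZero L]

/-! ## Generator words on integer classes -/

/-- one generator on an integer class `(k₂,k₃)`: `0` = `2 ↔ 3`, `1` = `1 ↔ 2` (`(k₂,k₃) ↦ ((1,0) − k₂ − k₃, k₃)`),
anything else = the `y`-reflection `((m₂,n₂),(m₃,n₃)) ↦ ((m₂,−n₂),(m₃,−n₃))`. -/
def genZ : ℕ → (ℤ × ℤ) × (ℤ × ℤ) → (ℤ × ℤ) × (ℤ × ℤ)
  | 0, kk => (kk.2, kk.1)
  | 1, kk => ((((1 : ℤ), (0 : ℤ)) - kk.1 - kk.2), kk.2)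
  | _ + 2, kk => ((kk.1.1, -kk.1.2), (kk.2.1, -kk.2.2))

/-- a word of generators, applied left to right. -/
def wordZ : List ℕ → (ℤ × ℤ) × (ℤ × ℤ) → (ℤ × ℤ) × (ℤ × ℤ)
  | [], kk => kk
  | g :: w, kk => wordZ w (genZ g kk)

section sym
variable {Δ lam2 : ℝ} {f : Tor L → ℝ}

omit [NeZero L] in
/-- `toTor` of the reflected integer vector is the reflected torus vector. [folklore] -/
theorem toTor_reflect (p : ℤ × ℤ) : B1.toTor L (p.1, -p.2) = ((B1.toTor L p).1, -(B1.toTor L p).2) := by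
  unfold B1.toTor; simp

/-- ★ one generator preserves the low-shell term (`L ≥ 2`). [folklore] -/
theorem lowTerm_genZ (hL : 2 ≤ L) (hf : IsGroundTwoMagnon L Δ lam2 f) (g : ℕ) (kk : (ℤ × ℤ) × (ℤ × ℤ)) :
    lowTerm L Δ f (B1.toTor L (genZ g kk).1) (B1.toTor L (genZ g kk).2)
      = lowTerm L Δ f (B1.toTor L kk.1) (B1.toTor L kk.2) := by
  match g with
  | 0 =>
      simp only [genZ]
      exact lowTerm_swap L hf _ _
  | 1 =>
      simp only [genZ]
      rw [RowC.toTor_sub, RowC.toTor_sub, ClosedExp.toTor_one_zero]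
      exact lowTerm_U12 L hf _ _
  | n + 2 =>
      simp only [genZ]
      rw [toTor_reflect, toTor_reflect]
      exact lowTerm_reflect L hL hf _ _

/-- ★ a generator word preserves the low-shell term. [folklore] -/
theorem lowTerm_wordZ (hL : 2 ≤ L) (hf : IsGroundTwoMagnon L Δ lam2 f) (w : List ℕ) :
    ∀ kk : (ℤ × ℤ) × (ℤ × ℤ), lowTerm L Δ f (B1.toTor L (wordZ w kk).1) (B1.toTor L (wordZ w kk).2)
      = lowTerm L Δ f (B1.toTor L kk.1) (B1.toTor L kk.2) := by
  induction w with
  | nil => intro kk; rfl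
  | cons g w ih => intro kk; simp only [wordZ]; rw [ih, lowTerm_genZ L hL hf]

end sym

/-! ## The orbit table -/

/-- a row `(k, j, w)` of the orbit table passes iff `w·k` is the `j`-th representative. -/
def orbitRowOk (reps : List (((ℤ × ℤ) × (ℤ × ℤ)) × ℚ)) (row : ((ℤ × ℤ) × (ℤ × ℤ)) × (ℕ × List ℕ)) : Bool :=
  match reps[row.2.1]? with
  | none => false
  | some r => decide (wordZ row.2.2 row.1 = r.1)

/-- the budget of a row: that of its representative. -/
def orbitBudget (reps : List (((ℤ × ℤ) × (ℤ × ℤ)) × ℚ)) (row : ((ℤ × ℤ) × (ℤ × ℤ)) × (ℕ × List ℕ)) : ℚ :=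
  match reps[row.2.1]? with
  | none => 0
  | some r => r.2

section sound
variable (Δ lam2 : ℝ) (f : Tor L → ℝ)

/-- ★ the common tail: a table `tbl = [(k, b_k)]` listing `lowList` with REAL row bounds `T(k) ≤ V²·θ²·b_k`, the budget
`Σ b_k ≤ 3·(98696/10⁴)·aD·ν₁·τlo`, `0 ≤ aD`, `0 ≤ τlo ≤ T⁺/θ²` and the `ν`-location give `lowG ≤ aD·η_eff·U` (`L ≥ 8`). [folklore] -/
theorem lowG_of_rowBounds (hL : 8 ≤ L) (hΔ1 : Δ < 1) (hf : IsGroundTwoMagnon L Δ lam2 f) (c : L2.NamedCell) (aD τlo : ℚ)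
    (tbl : List (((ℤ × ℤ) × (ℤ × ℤ)) × ℚ)) (htbl : tbl.map Prod.fst = lowList)
    (hrows : ∀ p ∈ tbl, lowTerm L Δ f (B1.toTor L p.1.1) (B1.toTor L p.1.2)
      ≤ ((L : ℝ) ^ 2) ^ 2 * (2 * Real.pi / L) ^ 2 * ((p.2 : ℚ) : ℝ))
    (hsum : (tbl.map Prod.snd).sum ≤ 3 * (98696 / 10000) * aD * ((c.n1 : ℚ) / c.νd) * τlo)
    (haD : 0 ≤ aD) (hτlo0 : 0 ≤ τlo) (hτlo : (τlo : ℝ) * (2 * Real.pi / L) ^ 2 ≤ Tplus L Δ f)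
    (hν1 : (c.n1 : ℝ) / c.νd ≤ lam2 / (2 * Real.pi / L) ^ 2) :
    lowGForm L Δ f ≤ (aD : ℝ) * etaEff L lam2 * Uunit L Δ f := by
  have hLpos : (0 : ℝ) < L := by exact_mod_cast (show 0 < L by omega)
  have ht : 0 < (2 * Real.pi / L : ℝ) ^ 2 := by positivity
  have hsum' : lowGForm L Δ f ≤ ((L : ℝ) ^ 2) ^ 2 * (2 * Real.pi / L) ^ 2 * (((tbl.map Prod.snd).sum : ℚ) : ℝ) := by
    rw [lowGForm_eq_listsum L Δ f hL, ← htbl, List.map_map]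
    have := listsum_le tbl _ (fun p => ((L : ℝ) ^ 2) ^ 2 * (2 * Real.pi / L) ^ 2 * ((p.2 : ℚ) : ℝ)) hrows
    refine this.trans (le_of_eq ?_)
    rw [List.sum_map_mul_left, Rat.cast_list_sum, List.map_map]
    rfl
  have hsumR : (((tbl.map Prod.snd).sum : ℚ) : ℝ) ≤ 3 * (98696 / 10000) * aD * ((c.n1 : ℝ) / c.νd) * τlo := by
    have := (Rat.cast_le (K := ℝ)).mpr hsum
    push_cast at this ⊢
    exact this
  have hπ2 : (98696 / 10000 : ℝ) ≤ Real.pi ^ 2 := by nlinarith [Real.pi_gt_d6, Real.pi_pos]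
  have haD' : (0 : ℝ) ≤ aD := by exact_mod_cast haD
  have hτ0' : (0 : ℝ) ≤ τlo := by exact_mod_cast hτlo0
  have hlam : 0 < lam2 := lam2_pos L (by omega) hΔ1 hf.1
  have hlt : 0 ≤ lam2 / (2 * Real.pi / L) ^ 2 := by positivity
  have hν' : 3 * (98696 / 10000) * (aD : ℝ) * ((c.n1 : ℝ) / c.νd) * τlo
      ≤ 3 * Real.pi ^ 2 * aD * (lam2 / (2 * Real.pi / L) ^ 2) * τlo := by
    have h1 : 0 ≤ (aD : ℝ) * τlo * (lam2 / (2 * Real.pi / L) ^ 2 - (c.n1 : ℝ) / c.νd) :=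
      mul_nonneg (mul_nonneg haD' hτ0') (sub_nonneg.2 hν1)
    have h2 : 0 ≤ (aD : ℝ) * τlo * (lam2 / (2 * Real.pi / L) ^ 2) * (Real.pi ^ 2 - 98696 / 10000) :=
      mul_nonneg (mul_nonneg (mul_nonneg haD' hτ0') hlt) (sub_nonneg.2 hπ2)
    nlinarith [h1, h2]
  have hRHS : (aD : ℝ) * etaEff L lam2 * Uunit L Δ f
      = ((L : ℝ) ^ 2) ^ 2 * (2 * Real.pi / L) ^ 2 * (3 * Real.pi ^ 2 * aD * (lam2 / (2 * Real.pi / L) ^ 2))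
        * (Tplus L Δ f / (2 * Real.pi / L) ^ 2) := by
    have hL0 : (L : ℝ) ≠ 0 := hLpos.ne'
    have hπ : Real.pi ≠ 0 := Real.pi_ne_zero
    unfold Uunit etaEff
    field_simp
    ring
  rw [hRHS]
  have hτ' : (τlo : ℝ) ≤ Tplus L Δ f / (2 * Real.pi / L) ^ 2 := by rw [le_div_iff₀ ht]; exact hτlo
  have hc0 : 0 ≤ ((L : ℝ) ^ 2) ^ 2 * (2 * Real.pi / L) ^ 2 * (3 * Real.pi ^ 2 * aD * (lam2 / (2 * Real.pi / L) ^ 2)) := by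
    positivity
  have hVt : 0 ≤ ((L : ℝ) ^ 2) ^ 2 * (2 * Real.pi / L) ^ 2 := by positivity
  calc lowGForm L Δ f ≤ ((L : ℝ) ^ 2) ^ 2 * (2 * Real.pi / L) ^ 2 * (((tbl.map Prod.snd).sum : ℚ) : ℝ) := hsum'
    _ ≤ ((L : ℝ) ^ 2) ^ 2 * (2 * Real.pi / L) ^ 2 * (3 * Real.pi ^ 2 * aD * (lam2 / (2 * Real.pi / L) ^ 2) * τlo) :=
        mul_le_mul_of_nonneg_left (hsumR.trans (by linarith)) hVt
    _ = ((L : ℝ) ^ 2) ^ 2 * (2 * Real.pi / L) ^ 2 * (3 * Real.pi ^ 2 * aD * (lam2 / (2 * Real.pi / L) ^ 2)) * τlo := by ring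
    _ ≤ _ := mul_le_mul_of_nonneg_left hτ' hc0

/-- ★★★ **ORBIT FORM of the row-D cell certificate**: representatives `reps = [(r_j, b_j)]` (each `r_j ∈ lowList` and passing ONE
kernel class check `classCheck … r_j b_j`, `hrepsCls`; `r_j ∈ lowList`, `hrepsMem`), an orbit table `orb = [(k, j, w)]` listing `lowList` with `w·k = r_j` (`orbitRowOk`,
pure integer `decide`), the budget `Σ_k b_{j(k)} ≤ 3·(98696/10⁴)·a_D·ν₁·τlo`, the `ê₁` check and the `τ` check give
`lowGForm ≤ a_D·η_eff·U` on the cell for every `L ≥ 128` — the `hKT2a` hypothesis of `gm3_of_cell`. -/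
theorem lowG_of_orbitChecks (c : L2.NamedCell) (a1 a2 aD τlo τhi : ℚ) (pi piT : ℕ × ℕ)
    (reps : List (((ℤ × ℤ) × (ℤ × ℤ)) × ℚ)) (orb : List (((ℤ × ℤ) × (ℤ × ℤ)) × (ℕ × List ℕ)))
    (hrepsMem : (reps.all fun p => decide (p.1 ∈ lowList)) = true)
    (hrepsCls : (reps.all fun p => classCheck c a1 a2 τlo τhi pi p.1 p.2) = true)
    (horb : orb.map Prod.fst = lowList) (hok : (orb.all (orbitRowOk reps)) = true)
    (hsum : (orb.map (orbitBudget reps)).sum ≤ 3 * (98696 / 10000) * aD * ((c.n1 : ℚ) / c.νd) * τlo)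
    (haD : 0 ≤ aD) (hτlo0 : 0 ≤ τlo) (he1 : e1Check c a1 a2 τhi pi = true) (hτ : tauCheck c a1 a2 τlo τhi piT = true)
    (hc : c.check = true) (hL : 128 ≤ L)
    (hΔ0 : 0 ≤ Δ) (hΔ1 : Δ < 1) (hf : IsGroundTwoMagnon L Δ lam2 f)
    (hν1 : (c.n1 : ℝ) / c.νd ≤ lam2 / (2 * Real.pi / L) ^ 2) (hν2 : lam2 / (2 * Real.pi / L) ^ 2 ≤ (c.n2 : ℝ) / c.νd)
    (ha1 : ((a1 : ℚ) : ℝ) ≤ Δ * f (K1 L)) (ha2 : Δ * f (K1 L) ≤ ((a2 : ℚ) : ℝ)) :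
    lowGForm L Δ f ≤ (aD : ℝ) * etaEff L lam2 * Uunit L Δ f := by
  obtain ⟨hτlo, hτhi⟩ := tau_of_tauCheck L Δ lam2 f c a1 a2 τlo τhi piT hτ hc hL hΔ0 hΔ1 hf hν1 hν2 ha1 ha2
  -- the box and the `ê₁` check
  unfold e1Check at he1
  split at he1
  · exact absurd he1 (by simp)
  · rename_i B hB
    have hmem := rowDBox_mem L Δ lam2 f c a1 a2 pi hB hc hL hΔ0 hΔ1 hf hν1 hν2 ha1 ha2
    have e1 := rexprLeOn_sound he1 _ hmem
    simp only [RExpr.eval, cst, vE1, xTrueD_e1] at e1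
    push_cast at e1
    have he1' : (τhi : ℝ) - 2 * (eps1 L / (2 * Real.pi / L) ^ 2) ≤ -1 / 1000 := by linarith
    -- the representatives: `T(r_j) ≤ V²t·b_j`
    have hrep : ∀ r ∈ reps, lowTerm L Δ f (B1.toTor L r.1.1) (B1.toTor L r.1.2)
        ≤ ((L : ℝ) ^ 2) ^ 2 * (2 * Real.pi / L) ^ 2 * ((r.2 : ℚ) : ℝ) := by
      intro r hr
      have hmemL : r.1 ∈ lowList := of_decide_eq_true (List.all_eq_true.mp hrepsMem r hr)
      have hcls := List.all_eq_true.mp hrepsCls r hr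
      have h1 := class_le L Δ lam2 f hL hΔ0 hΔ1 hf τlo τhi hτlo hτhi he1' hmemL
      unfold classCheck at hcls
      rw [hB] at hcls
      have h3 := rexprLeOn_sound hcls _ hmem
      exact h1.trans (mul_le_mul_of_nonneg_left h3 (by positivity))
    -- the rows: `T(k) = T(w·k) = T(r_j) ≤ V²t·b_j`
    refine lowG_of_rowBounds L Δ lam2 f (by omega) hΔ1 hf c aD τlo (orb.map fun row => (row.1, orbitBudget reps row))
      (by rw [List.map_map]; exact horb) ?_ (by rw [List.map_map]; exact hsum) haD hτlo0 hτlo hν1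
    intro p hp
    obtain ⟨row, hrow, rfl⟩ := List.mem_map.mp hp
    have hok1 := List.all_eq_true.mp hok row hrow
    unfold orbitRowOk at hok1
    unfold orbitBudget
    split at hok1
    · exact absurd hok1 (by simp)
    · rename_i r hr
      have hw : wordZ row.2.2 row.1 = r.1 := of_decide_eq_true hok1
      have hrmem : r ∈ reps := List.mem_of_getElem? hr
      have key := lowTerm_wordZ L (by omega) hf row.2.2 row.1
      rw [hw] at key
      show lowTerm L Δ f (B1.toTor L row.1.1) (B1.toTor L row.1.2) ≤ _
      rw [← key]
      exact hrep r hrmem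

end sound

end RowD

end Summit.HubbardSuperconductivity.HubbardSuperconductivity.Theorems.AnisotropyChord.Transfer.Fibre3
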